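/-
Copyright (c) 2026. All rights reserved.
Released under Apache 2.0 license as described in the file LICENSE.
Authors: solo-Langlands-informed (ideation tier, family 6).
-/
import Literature.NumberTheory.PAdicHodge.DeRhamRankOneEmbeddingPeriods
import Literature.NumberTheory.PAdicHodge.BdRUnramified
import Literature.NumberTheory.GaloisRepresentations.ModNCyclotomicCharacter
import HarnessLib

/-!
# Unramified characters with coefficients are `ℂ_F`-admissible at every embedding

`Proofs`-style file (theorems only).  Topic `NumberTheory/PAdicHodge`; namespace
`Literature.NumberTheory.PAdicHodge.DeRhamRankOne`.

**What is printed.**  Serre (1968), Ch. III App. A.1–A.2 (after Tate 1967 §3.3) and Sen (1973):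
an unramified character `μ : Γ_F → E×` (`E/ℚ_p` finite) is `ℂ_F`-admissible — for every
`ℚ_p`-embedding `j : E → F̄` there is `y ∈ ℂ_F`, `y ≠ 0`, with `y = j(μ σ) · σ(y)` on the stabiliser of
`j` (Hilbert 90 / Lang's theorem over `𝒪̂_{F^{nr}}`; Hodge–Tate weight `0`).  Fontaine
(Astérisque 223, Exp. III §1.5, §5): unramified representations are even `B_dR`-admissible.

**What is proved here.**  `exists_theta_period_of_unramified` — for a continuous unramified
character `μ : Γ_F →ₜ* Eˣ` with `E ⊆ ℚ̄_p` finite over `ℚ_p` and every `j : E →ₐ[ℚ_p] F̄`: some `n ∈ ℤ`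
and `y ∈ ℂ_F ∖ 0` with `y = j(μ σ) · χ(σ)^n · σ(y)` whenever `σ ∘ j = j` (`χ` the cyclotomic
character read in `ℂ_F`).  Route: the rank-one framed representation `FramedRep.ofCharacter μ`
is unramified, hence `B_dR(F)`-admissible (tree `isAdmissible_bdR_of_unramified`, periods in
`W(k̄) ⊆ B_dR⁺`), and `exists_theta_period_of_isDeRham_bdR` (`θ`-reduction of the `B_dR`-period at
`j`) applies.  The exponent `n` is in fact `0`; the statement with an unspecified `n` is what the
`θ`-reduction gives and all that Tate's local-algebraicity argument uses.

## References
* [SerreAbelianLadic1968] J.-P. Serre, *Abelian ℓ-adic representations and elliptic curves* (1968), Ch. III, App. A.1–A.2.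
* [Tate1967] J. Tate, *p-divisible groups* (1967), §3.3.
* [FontaineAsterisque223III] J.-M. Fontaine, Astérisque 223 (1994), Exp. III §1.5, §5.
* [FontaineOuyang2022] J.-M. Fontaine, Y. Ouyang, *Theory of p-adic Galois representations*, Prop. 2.14.
-/

noncomputable section

open Field ValuativeRel Matrix
open scoped MatrixGroups

namespace Literature.NumberTheory.PAdicHodge

open Literature.NumberTheory.GaloisRepresentations
open Literature.NumberTheory.GaloisRepresentations.IsNonarchimedeanLocalField
open Literature.NumberTheory.Automorphic

namespace DeRhamRankOne

variable {F : Type} [Field F] [ValuativeRel F] [TopologicalSpace F] [IsNonarchimedeanLocalField F]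
  [CharZero F] {p : ℕ} [Fact p.Prime] (hp : valuation F p < 1)

-- Mathlib's own global value of `maxSynthPendingDepth` (as in `isAdmissible_bdR_of_unramified`).
set_option maxSynthPendingDepth 3 in
/-- **Unramified characters are `ℂ_F`-admissible (up to a cyclotomic twist) at every embedding.**
Let `μ : Γ_F →ₜ* Eˣ` be a continuous character, `E ⊆ ℚ̄_p` finite over `ℚ_p`, trivial on the inertia
group, and `j : E → F̄` a `ℚ_p`-embedding.  Then for some `n ∈ ℤ` there is `y ∈ ℂ_F`, `y ≠ 0`, with
`y = j(μ σ) · χ(σ)^n · σ(y)` for all `σ ∈ Γ_F` with `σ ∘ j = j`.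
[cite: SerreAbelianLadic1968, Ch. III §A.1–A.2] [cite: FontaineAsterisque223III, Exp. III §1.5 and §5]
[cite: FontaineOuyang2022, Prop. 2.14] -/
theorem exists_theta_period_of_unramified [Algebra ℚ_[p] F]
    [Fact (¬ IsUnit ((p : ℕ) : integerC F))]
    [IsAdicComplete (Ideal.span {((p : ℕ) : integerC F)}) (integerC F)]
    {E : IntermediateField ℚ_[p] (PadicAlgCl p)} [FiniteDimensional ℚ_[p] E]
    (μ : absoluteGaloisGroup F →ₜ* (E)ˣ) (hμ : ∀ σ ∈ absInertia F, μ σ = 1)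
    (j : E →ₐ[ℚ_[p]] AlgebraicClosure F) :
    ∃ (n : ℤ) (y : CompletedAlgClosure F), y ≠ 0 ∧ ∀ σ : absoluteGaloisGroup F, (∀ x : E, σ • j x = j x) →
      y = algClosureToC F (j ((μ σ : (E)ˣ) : E)) *
        (algebraMap F (CompletedAlgClosure F)
          (LocalField.padicRingHom F p hp
            (((GaloisRep.cyclotomicCharacter F p σ : ℤ_[p]ˣ) : ℤ_[p]) : ℚ_[p]))) ^ n * σ • y := by
  classical
  haveI : FiniteDimensional ℚ_[p] (Fin 1 → E) := inferInstance
  -- the rank-one framed representation of `μ` is unramified, hence `B_dR`-admissible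
  have hdR : (restrictScalarsQl E (FramedRep.ofCharacter μ)).IsDeRham
      (bdRPeriodRingData (F := F) (p := p) hp) := by
    refine isAdmissible_bdR_of_unramified hp _ (fun σ hσ v => ?_)
    funext i
    rw [restrictScalarsQl_apply_apply, FramedRep.toContinuousRep_apply_apply]
    simp only [Matrix.mulVec, dotProduct, Fin.sum_univ_one, FramedRep.ofCharacter_apply_coe, hμ σ hσ,
      Units.val_one, one_mul, Subsingleton.elim i 0]
  obtain ⟨n, y, hy0, hy⟩ := exists_theta_period_of_isDeRham_bdR hp (FramedRep.ofCharacter μ) hdR j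
  refine ⟨n, y, hy0, fun σ hσ => ?_⟩
  have h := hy σ hσ
  rwa [FramedRep.ofCharacter_apply_coe] at h

/-- **Unramified characters are `ℂ_F`-admissible at every embedding**, `MonoidHom` form: the same
for `μ : Γ_F →* Eˣ` with `Continuous μ`. [cite: SerreAbelianLadic1968, Ch. III §A.1–A.2]
[cite: FontaineAsterisque223III, Exp. III §1.5 and §5] -/
theorem exists_theta_period_of_unramified' [Algebra ℚ_[p] F]
    [Fact (¬ IsUnit ((p : ℕ) : integerC F))]
    [IsAdicComplete (Ideal.span {((p : ℕ) : integerC F)}) (integerC F)]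
    {E : IntermediateField ℚ_[p] (PadicAlgCl p)} [FiniteDimensional ℚ_[p] E]
    (μ : absoluteGaloisGroup F →* (E)ˣ) (hμc : Continuous μ) (hμ : ∀ σ ∈ absInertia F, μ σ = 1)
    (j : E →ₐ[ℚ_[p]] AlgebraicClosure F) :
    ∃ (n : ℤ) (y : CompletedAlgClosure F), y ≠ 0 ∧ ∀ σ : absoluteGaloisGroup F, (∀ x : E, σ • j x = j x) →
      y = algClosureToC F (j ((μ σ : (E)ˣ) : E)) *
        (algebraMap F (CompletedAlgClosure F)
          (LocalField.padicRingHom F p hp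
            (((GaloisRep.cyclotomicCharacter F p σ : ℤ_[p]ˣ) : ℤ_[p]) : ℚ_[p]))) ^ n * σ • y :=
  exists_theta_period_of_unramified hp (ContinuousMonoidHom.mk μ hμc) hμ j

end DeRhamRankOne

end Literature.NumberTheory.PAdicHodge
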